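import Literature.NumberTheory.EllipticCurves.UniformizationHolomorphic
import Literature.NumberTheory.Transcendental.AnalytificationSeparatedProofs
import Literature.Geometry.Kaehler.ComplexTorusCover
import Mathlib.Topology.Homeomorph.Lemmas
import HarnessLib

/-!
# The complex torus `ℂ/Λ` is the analytification of the elliptic curve `E_Λ`

Silverman, *The Arithmetic of Elliptic Curves*, Prop. VI.3.6 (b): "`φ : ℂ/Λ → E(ℂ)`,
`z ↦ [℘(z), ℘'(z), 1]`, is a complex analytic isomorphism of complex Lie groups". This file
proves the complex-analytic content of that statement in the language of the tree: for a period
pair `L` (lattice `Λ = ℤω₁ + ℤω₂`), the complex torus `L.torus = ℂ/Λ`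
(`Literature.Geometry.Kaehler.ComplexTorus` of the period isomorphism `L.periodIso : ℝ² ≃ ℂ`,
`(x₀, x₁) ↦ x₀ω₁ + x₁ω₂`; a compact complex manifold charted on `ℂ`) maps by the descent
`L.torusPoint` of the uniformisation `L.upoint : ℂ → E_Λ(ℂ)` (`UniformizationHolomorphic.lean`)
HOMEOMORPHICALLY onto the complex points of the smooth projective curve `E_Λ = L.curve.scheme`
(strong topology), and this map is an ANALYTIFICATION
(`Literature.NumberTheory.Transcendental.IsAnalytification`, Serre GAGA §2): regular functions on
affine opens of `E_Λ` pull back to holomorphic functions on `ℂ/Λ`.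

* `PeriodPair.periodIso`, `PeriodPair.torus`, `cover_eq_cover_iff` (`π z = π z' ↔ z − z' ∈ Λ`);
* `PeriodPair.torusPoint`, `torusPoint_cover` (`torusPoint ∘ π = upoint`), `torusPoint_injective`,
  `torusPoint_surjective`, `continuous_torusPoint`, `isHomeomorph_torusPoint`;
* **`PeriodPair.isAnalytification_torusPoint : IsAnalytification ℂ L.curve.scheme 1 L.torusPoint`.**

By uniqueness of the analytification (`IsAnalytification.unique`) `ℂ/Λ` is thus biholomorphic to
`E_Λ(ℂ)` with its structure of complex manifold. The group-theoretic half of VI.3.6 (b) is the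
tree's `PeriodPair.toPoint_add` (`ComplexTorus.lean`, `ComplexTorusAddProofs.lean`). Everything
here is proved; no named facts.

## References

* J. H. Silverman, *The Arithmetic of Elliptic Curves*, 2nd ed., GTM 106 (2009), Prop. VI.3.6 (b).
  [SilvermanAEC2009]
* J.-P. Serre, *Géométrie algébrique et géométrie analytique* (1956), §2 n°5–6. [SerreGAGA1956]
* H. Lange, Ch. Birkenhake, *Complex Abelian Varieties* (1992), §1.1.1. [LangeBirkenhake1992]

## Design

Deliberate dot-notation extensions in Mathlib's `namespace PeriodPair`, as the sibling preludes.
-/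

noncomputable section

open CategoryTheory AlgebraicGeometry Complex Metric Set Filter
open scoped Manifold ContDiff Topology
open Literature.AlgebraicGeometry.Motives Literature.AlgebraicGeometry.Motives.AlgPoints
open Literature.NumberTheory.Transcendental Literature.Geometry.Kaehler

namespace PeriodPair

variable (L : PeriodPair)

/-! ### The torus `ℂ/Λ` -/

/-- **The period isomorphism** `ℝ² ≃ ℂ`, `(x₀, x₁) ↦ x₀ω₁ + x₁ω₂` (coordinates in the lattice
basis; Mathlib `PeriodPair.basis`). [cite: LangeBirkenhake1992, §1.1.1] -/
def periodIso : (Fin 2 → ℝ) ≃L[ℝ] ℂ :=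
  L.basis.equivFun.symm.toContinuousLinearEquiv

/-- `periodIso (x₀, x₁) = x₀ω₁ + x₁ω₂`. [folklore] -/
theorem periodIso_apply (x : Fin 2 → ℝ) : L.periodIso x = (x 0 : ℂ) * L.ω₁ + (x 1 : ℂ) * L.ω₂ := by
  change L.basis.equivFun.symm x = _
  rw [Module.Basis.equivFun_symm_apply, Fin.sum_univ_two, basis_zero, basis_one, Complex.real_smul,
    Complex.real_smul]

/-- **The complex torus `ℂ/Λ`** of the lattice of `L`, as a compact complex manifold charted on
`ℂ` (`Literature.Geometry.Kaehler.ComplexTorus`). [cite: LangeBirkenhake1992, §1.1.1] -/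
abbrev torus : Type := ComplexTorus L.periodIso

/-- **`π z = π z' ↔ z − z' ∈ Λ`** for the covering map `π = cover : ℂ → ℂ/Λ`.
[cite: LangeBirkenhake1992, §1.1.1] -/
theorem cover_eq_cover_iff (z z' : ℂ) :
    ComplexTorus.cover L.periodIso z = ComplexTorus.cover L.periodIso z' ↔ z - z' ∈ L.lattice := by
  have key : ∀ w : ℂ, ComplexTorus.cover L.periodIso w = ComplexTorus.cover L.periodIso 0 ↔
      w ∈ L.lattice := by
    intro w
    constructor
    · intro h
      have hp : ∀ p, ∃ n : ℤ, (L.periodIso.symm w p : ℝ) = n := by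
        intro p
        have hp' := congrFun h p
        simp only [ComplexTorus.cover_apply, ComplexTorus.proj_apply, map_zero, Pi.zero_apply,
          QuotientAddGroup.mk_zero] at hp'
        obtain ⟨n, hn⟩ := (AddCircle.coe_eq_zero_iff (1 : ℝ)).mp hp'
        exact ⟨n, by rw [← hn, zsmul_eq_mul, mul_one]⟩
      choose N hN using hp
      have hw : w = L.periodIso (fun p ↦ (N p : ℝ)) := by
        have : L.periodIso.symm w = fun p ↦ (N p : ℝ) := funext hN
        rw [← this, ContinuousLinearEquiv.apply_symm_apply]
      rw [mem_lattice]
      refine ⟨N 0, N 1, ?_⟩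
      rw [hw, periodIso_apply]
      push_cast
      ring
    · intro h
      obtain ⟨m, n, hmn⟩ := mem_lattice.mp h
      have hw : w = L.periodIso ![(m : ℝ), (n : ℝ)] := by
        rw [periodIso_apply, ← hmn]
        simp only [Matrix.cons_val_zero, Matrix.cons_val_one]
        push_cast
        ring
      funext p
      rw [ComplexTorus.cover_apply, ComplexTorus.cover_apply, ComplexTorus.proj_apply,
        ComplexTorus.proj_apply, hw, ContinuousLinearEquiv.symm_apply_apply, map_zero, Pi.zero_apply,
        QuotientAddGroup.mk_zero, AddCircle.coe_eq_zero_iff]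
      fin_cases p
      · exact ⟨m, by simp⟩
      · exact ⟨n, by simp⟩
  have hsub : ComplexTorus.cover L.periodIso z = ComplexTorus.cover L.periodIso z' ↔
      ComplexTorus.cover L.periodIso (z - z') = ComplexTorus.cover L.periodIso 0 := by
    simp only [ComplexTorus.cover_apply, map_sub, map_zero]
    constructor
    · intro h
      funext p
      have hp := congrFun h p
      simp only [ComplexTorus.proj_apply, Pi.sub_apply, Pi.zero_apply] at hp ⊢
      rw [AddCircle.coe_sub, hp, sub_self, QuotientAddGroup.mk_zero]
    · intro h
      funext p
      have hp := congrFun h p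
      simp only [ComplexTorus.proj_apply, Pi.sub_apply, Pi.zero_apply, QuotientAddGroup.mk_zero,
        AddCircle.coe_sub, sub_eq_zero] at hp ⊢
      exact hp
  rw [hsub, key]

/-! ### The comparison map `ℂ/Λ → E_Λ(ℂ)` -/

/-- **The map `φ : ℂ/Λ → E_Λ(ℂ)`** of Silverman VI.3.6 (b), with values in the complex points of the
scheme `E_Λ`: `upoint` on the standard lift (well defined by `Λ`-periodicity, `torusPoint_cover`).
[cite: SilvermanAEC2009, Prop. VI.3.6 (b)] -/
def torusPoint (t : L.torus) : AlgPoints L.curve.scheme ℂ :=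
  L.upoint (L.periodIso (ComplexTorus.lift L.periodIso t))

/-- **`torusPoint ∘ π = upoint`.** [cite: SilvermanAEC2009, Prop. VI.3.6 (b)] -/
theorem torusPoint_cover (z : ℂ) : L.torusPoint (ComplexTorus.cover L.periodIso z) = L.upoint z := by
  apply upoint_eq_upoint_iff.mpr
  apply (L.cover_eq_cover_iff _ _).mp
  rw [ComplexTorus.cover_apply, ContinuousLinearEquiv.symm_apply_apply, ComplexTorus.proj_lift]

/-- **`φ` is injective** (`upoint z = upoint w ↔ z ≡ w mod Λ`). [cite: SilvermanAEC2009, Prop. VI.3.6 (b)] -/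
theorem torusPoint_injective : Function.Injective L.torusPoint := by
  intro t t' h
  obtain ⟨z, rfl⟩ := ComplexTorus.cover_surjective L.periodIso t
  obtain ⟨z', rfl⟩ := ComplexTorus.cover_surjective L.periodIso t'
  rw [torusPoint_cover, torusPoint_cover] at h
  exact (L.cover_eq_cover_iff z z').mpr (upoint_eq_upoint_iff.mp h)

/-- **`φ` is surjective.** [cite: SilvermanAEC2009, Prop. VI.3.6 (b)] -/
theorem torusPoint_surjective : Function.Surjective L.torusPoint := by
  intro Q
  obtain ⟨z, rfl⟩ := L.upoint_surjective Q
  exact ⟨ComplexTorus.cover L.periodIso z, L.torusPoint_cover z⟩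

/-- Over the domain of a chart of `ℂ/Λ`, `φ = upoint ∘ chart`. [folklore] -/
theorem upoint_chartAt {t s : L.torus} (hs : s ∈ (chartAt ℂ t).source) :
    L.upoint (chartAt ℂ t s) = L.torusPoint s := by
  have hs' : ComplexTorus.cover L.periodIso (chartAt ℂ t s) = s := by
    rw [ComplexTorus.chartAt_eq, ← ComplexTorus.chart_symm_eq_cover L.periodIso
      (ComplexTorus.corner L.periodIso t)]
    exact (ComplexTorus.chart L.periodIso _).left_inv hs
  rw [← torusPoint_cover, hs']

/-- **`φ` is continuous** (over each chart it is `upoint ∘ chart`). [cite: SilvermanAEC2009, Prop. VI.3.6 (b)] -/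
theorem continuous_torusPoint : Continuous L.torusPoint := by
  refine continuous_iff_continuousAt.mpr fun t ↦ ?_
  have heq : (fun s ↦ L.upoint (chartAt ℂ t s)) =ᶠ[𝓝 t] L.torusPoint := by
    filter_upwards [(chartAt ℂ t).open_source.mem_nhds (mem_chart_source _ t)] with s hs
    exact L.upoint_chartAt hs
  refine ContinuousAt.congr ?_ heq
  exact L.continuous_upoint.continuousAt.comp ((chartAt ℂ t).continuousAt (mem_chart_source _ t))

/-- **`φ : ℂ/Λ → E_Λ(ℂ)` is a homeomorphism** (continuous bijection, compact onto Hausdorff —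
`E_Λ(ℂ)` is Hausdorff as `E_Λ` is separated). [cite: SilvermanAEC2009, Prop. VI.3.6 (b)] -/
theorem isHomeomorph_torusPoint : IsHomeomorph L.torusPoint := by
  haveI : T2Space (AlgPoints L.curve.scheme ℂ) := ComplexPoints.t2Space_of_isSeparated L.curve.scheme
  exact isHomeomorph_iff_continuous_bijective.mpr
    ⟨L.continuous_torusPoint, L.torusPoint_injective, L.torusPoint_surjective⟩

/-- **`ℂ/Λ` is the analytification of `E_Λ`** (Silverman, *AEC* VI Prop. 3.6 (b): "`φ` is a complex
analytic isomorphism"; Serre, GAGA §2): `φ = torusPoint` is a homeomorphism onto `E_Λ(ℂ)`, the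
model `ℂ` has dimension `1`, and regular functions on affine opens of `E_Λ` pull back to
holomorphic functions on `ℂ/Λ` (in the charts they are the functions `g ∘ upoint`, holomorphic by
`differentiableOn_evalOrZero_upoint`). [cite: SilvermanAEC2009, Prop. VI.3.6 (b)] [cite: SerreGAGA1956, §2 n°5] -/
theorem isAnalytification_torusPoint : IsAnalytification ℂ L.curve.scheme 1 L.torusPoint where
  isHomeomorph := L.isHomeomorph_torusPoint
  finrank_eq := Module.finrank_self ℂ
  mdifferentiableOn_evalOrZero U s := by
    intro t ht
    refine MDifferentiableAt.mdifferentiableWithinAt ?_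
    rw [mdifferentiableAt_iff]
    refine ⟨?_, ?_⟩
    · exact ((continuousOn_evalOrZero _ s).continuousAt ((isOpen_setOf_pt_mem _).mem_nhds ht)).comp
        L.continuous_torusPoint.continuousAt
    · have hw : writtenInExtChartAt 𝓘(ℂ, ℂ) 𝓘(ℂ, ℂ) t (fun m ↦ evalOrZero (↑U) s (L.torusPoint m)) =
          fun z ↦ evalOrZero (↑U) s (L.upoint z) := by
        funext z
        simp only [writtenInExtChartAt, extChartAt_model_space_eq_id, PartialEquiv.refl_coe,
          Function.comp_apply, id_eq]
        rw [ComplexTorus.extChartAt_symm_eq_cover, torusPoint_cover]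
      rw [hw]
      refine DifferentiableAt.differentiableWithinAt ?_
      have hz : L.upoint (extChartAt 𝓘(ℂ, ℂ) t t) = L.torusPoint t := by
        rw [← torusPoint_cover, ComplexTorus.cover_extChartAt_self]
      refine (L.differentiableOn_evalOrZero_upoint U s).differentiableAt
        (((isOpen_setOf_pt_mem _).preimage L.continuous_upoint).mem_nhds ?_)
      change (L.upoint (extChartAt 𝓘(ℂ, ℂ) t t)).pt ∈ (↑U : L.curve.scheme.left.Opens)
      rw [hz]
      exact ht

end PeriodPair
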